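import Literature.AnabelianGeometry.SemiGraphs.PSCAuxiliaryCoveringsGenuineOrigins
import Literature.AnabelianGeometry.SemiGraphs.PSCTwoComponentOriginRows
import Literature.AnabelianGeometry.SemiGraphs.PSCTwoComponentShape
import HarnessLib

/-!
# [CombGC] Rmk. 1.4.3 (2007 text; FACT-LIST row F-0466) DECIDED at the two-component origin: the verticial conjunct fails at sturdy data

Mochizuki, *A combinatorial version of the Grothendieck conjecture*, Tohoku Math. J. **59** (2007)
[CombGC], Rmk. 1.4.3 p. 12, verticial case (`G` sturdy, `Π^unr_G`-coverings): for `G' → G` as in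
Rmk. 1.4.2, a verticially totally ramified `Π^unr_G`-covering, and a vertex `e` over which it is
connected, "There exists a finite étale `Π^unr_G`-covering `G'' → G` such that: (a) `G'' → G` is trivial
over `G_e`; (b) the subcovering `G''' → G''` … is verticially purely totally ramified"; typed by
abc-iut-L3-t4 as `VerticialAuxiliaryCoveringExists`, third conjunct of the origin schema
`AuxiliaryCoveringsExistHolds Ω` (row F-0466); Def. 1.4 (v) p. 11; the author's correction [IUTchI]
Rmk. 1.2.3 (i)(ii) pp. 41–43 replaces Rmk. 1.4.3. [cite: MochizukiCombGC2007, Rmk 1.4.3 p.12]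
[cite: MochizukiCombGC2007, Def 1.4(v) p.11] [cite: Mochizuki2012, IUTchI Rmk 1.2.3(ii) p.41]

PROOF-ONLY file (abc-iut cell, layer L3, L-F sub-cell [SemiAnbd]+[CombGC] pack C, row «F-0466 at the
two-component origins», seat abc-iut-w5-d174 gen 5; companion of `PSCAuxiliaryCoveringsGenuineOrigins.lean`).
abc-iut-L3-t4's `smul_vertGp_le_of_verticialAuxiliaryCoveringExists` (`PSCAuxiliaryCoveringsSmoothCurve.lean`)
certified the MECHANISM ("the verticial conjunct fails at any genuine datum with two vertices admitting an
`l`-cyclic `Π^unr`-covering connected over both … the tree has no genuine multi-vertex PSC datum yet");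
abc-iut-f-165 / abc-iut-w4-d052 have since supplied genuine multi-vertex data — the two-component origin
`Ω_tc` (`exists_twoComponentOrigin_rows`, membership predicate exposed as an `↔`).  This file runs the
mechanism there:

* `not_verticialAuxiliaryCoveringExists_of_twoComponent` — the verticial conjunct FAILS at every sturdy
  datum of two-component shape with `Σ = {ℓ}`: the `Π^unr`-character `a_0 ↦ 1`, `a_{g₁} ↦ 1` (values in
  `ℤ/ℓ`, continuous by the pro-`Σ` universal property) is an `ℓ`-cyclic `Π^unr`-covering connected over
  both components;
* `cuspidal_and_nodalAuxiliaryCoveringExists_of_twoComponent` — the cuspidal (no cusps) and nodal (one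
  node) conjuncts HOLD at every such datum;
* `not_auxiliaryCoveringsExistHolds_of_twoComponentOrigin`, `exists_twoComponentOrigin_auxiliaryCoverings_row`
  — **`¬ AuxiliaryCoveringsExistHolds Ω_tc`**, with the per-datum truth table of the three conjuncts at
  `Ω_tc` (verticial: true exactly at the non-sturdy data and at the data whose `Σ` is not a singleton).

0 definitions.  A kernel decision of OUR typed 2007 statement at genuine multi-vertex data, consistent with
the author's 2012 withdrawal of it; nothing here concerns the corrected statements, and nothing here takes
a side on [IUTchIII] Cor. 3.12.
-/

noncomputable section

namespace Literature.AnabelianGeometry.SemiGraphs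

namespace PSCDatum

open scoped Pointwise
open Multiplicative
open Literature.GroupTheory.CombinatorialGroupTheory
open Literature.AnabelianGeometry.Anabelioids (IsSigmaInteger)
open SemiGraphOfAnabelioids (IsProSigmaCompletion)

universe u

variable {P : Type u} [Group P] [TopologicalSpace P] [IsTopologicalGroup P]

/-! ### A subgroup meeting a character of prime order nontrivially supplements its kernel -/

-- (private copies of the two plumbing lemmas of `PSCAuxiliaryCoveringsGenuineOrigins.lean`)

omit [TopologicalSpace P] [IsTopologicalGroup P] in
/-- If `χ : Π → ℤ/ℓ` (`ℓ` prime) takes the value `1` on some element of `K`, then `K · Ker χ = Π`.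
[folklore] -/
private theorem sup_ker_eq_top_of_apply_eq {ℓ : ℕ} [Fact (1 < ℓ)] (hℓ : ℓ.Prime)
    (χ : P →* Multiplicative (ZMod ℓ)) (K : Subgroup P) {x : P} (hx : x ∈ K) (hχx : χ x = ofAdd 1) :
    K ⊔ χ.ker = ⊤ := by
  haveI : Fact (Nat.card (Multiplicative (ZMod ℓ))).Prime :=
    ⟨by rw [show Nat.card (Multiplicative (ZMod ℓ)) = ℓ from Nat.card_zmod ℓ]; exact hℓ⟩
  have hmap : (K ⊔ χ.ker).map χ = ⊤ := by
    refine ((K ⊔ χ.ker).map χ).eq_bot_or_eq_top_of_prime_card.resolve_left fun hbot => ?_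
    have hmem : χ x ∈ (K ⊔ χ.ker).map χ := Subgroup.mem_map_of_mem χ (Subgroup.mem_sup_left hx)
    rw [hbot, Subgroup.mem_bot, hχx] at hmem
    exact one_ne_zero (ofAdd_eq_one.mp hmem)
  have h := Subgroup.comap_map_eq χ (K ⊔ χ.ker)
  rw [hmap, Subgroup.comap_top, sup_assoc, sup_idem] at h
  exact h.symm

omit [TopologicalSpace P] [IsTopologicalGroup P] in
/-- The kernel of a character `Π → ℤ/ℓ` (`ℓ` prime) taking the value `1` has index `ℓ`. [folklore] -/
private theorem index_ker_eq_of_apply_eq {ℓ : ℕ} [Fact (1 < ℓ)] (hℓ : ℓ.Prime)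
    (χ : P →* Multiplicative (ZMod ℓ)) {x : P} (hχx : χ x = ofAdd 1) : χ.ker.index = ℓ := by
  haveI : Fact (Nat.card (Multiplicative (ZMod ℓ))).Prime :=
    ⟨by rw [show Nat.card (Multiplicative (ZMod ℓ)) = ℓ from Nat.card_zmod ℓ]; exact hℓ⟩
  have hrange : χ.range = ⊤ := by
    refine χ.range.eq_bot_or_eq_top_of_prime_card.resolve_left fun hbot => ?_
    have hmem : χ x ∈ χ.range := ⟨x, rfl⟩
    rw [hbot, Subgroup.mem_bot, hχx] at hmem
    exact one_ne_zero (ofAdd_eq_one.mp hmem)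
  rw [Subgroup.index_ker, hrange, Subgroup.card_top]
  exact Nat.card_zmod ℓ

/-! ### The verticial conjunct at data of two-component shape -/

section TwoComponent

variable [CompactSpace P] [TotallyDisconnectedSpace P]

/-- **The typed [CombGC] Rmk. 1.4.3 (verticial case) FAILS at every STURDY datum of two-component shape
with `Σ = {ℓ}`** (abc-iut-f-165's shape: no cusps, two vertices `v₀ ≠ v₁` carrying the closures of the
two handle groups along a profinite pro-`Σ` completion `ι : Γ_{g₁+g₂,0} → Π`, node groups the closure of
the vanishing cycle `∏_{i<g₁}[a_i,b_i]`).  The character `a_0 ↦ 1`, `a_{g₁} ↦ 1` (all other generators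
`↦ 0`) with values in `ℤ/ℓ` extends continuously to `Π` and kills the node groups, hence
`Ker(Π ↠ Π^unr)`: its kernel is a normal open `Π^unr`-covering of index `ℓ` totally ramified at `v₀`, so
abc-iut-L3-t4's `smul_vertGp_le_of_verticialAuxiliaryCoveringExists` would put `Π_{v₁}` inside it — but
the character is `1 ≠ 0` on `ι(a_{g₁}) ∈ Π_{v₁}` ("an `ℓ`-cyclic `Π^unr`-covering connected over both
components"). [cite: MochizukiCombGC2007, Rmk 1.4.3 p.12] -/
theorem not_verticialAuxiliaryCoveringExists_of_twoComponent (G : PSCDatum P) {ℓ : ℕ}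
    (hSig : G.Sigma = {ℓ}) {g₁ g₂ : ℕ} (h₁ : 0 < g₁) (h₂ : 0 < g₂)
    (ι : PuncturedSurfaceGroup (g₁ + g₂) 0 →* P) (hι : IsProSigmaCompletion G.Sigma ι)
    [IsEmpty G.graph.C] (v₀ v₁ : G.graph.V) (hne : v₀ ≠ v₁)
    (hV₀ : G.vertGp v₀ = ((Subgroup.closure
      (Set.range (fun i : Fin g₁ => PuncturedSurfaceGroup.a (r := 0) (Fin.castAdd g₂ i)) ∪
        Set.range (fun i : Fin g₁ => PuncturedSurfaceGroup.b (r := 0) (Fin.castAdd g₂ i)))).map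
          ι).topologicalClosure)
    (hV₁ : G.vertGp v₁ = ((Subgroup.closure
      (Set.range (fun j : Fin g₂ => PuncturedSurfaceGroup.a (r := 0) (Fin.natAdd g₁ j)) ∪
        Set.range (fun j : Fin g₂ => PuncturedSurfaceGroup.b (r := 0) (Fin.natAdd g₁ j)))).map
          ι).topologicalClosure)
    (hN : ∀ e, G.nodeGp e = ((Subgroup.zpowers (List.ofFn fun i : Fin g₁ =>
      PuncturedSurfaceGroup.a (g := g₁ + g₂) (r := 0) (Fin.castAdd g₂ i) *
        PuncturedSurfaceGroup.b (Fin.castAdd g₂ i) * (PuncturedSurfaceGroup.a (Fin.castAdd g₂ i))⁻¹ *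
          (PuncturedSurfaceGroup.b (Fin.castAdd g₂ i))⁻¹).prod).map ι).topologicalClosure)
    (hst : G.IsSturdy) : ¬ G.VerticialAuxiliaryCoveringExists := by
  classical
  intro hAux
  have hl : ℓ.Prime := G.prime_of_sigma_eq hSig
  haveI : Fact (1 < ℓ) := ⟨hl.one_lt⟩
  -- the two distinguished handle generators
  set i₀ : Fin (g₁ + g₂) := Fin.castAdd g₂ ⟨0, h₁⟩ with hi₀
  set i₁ : Fin (g₁ + g₂) := Fin.natAdd g₁ ⟨0, h₂⟩ with hi₁
  have hii : i₀ ≠ i₁ := by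
    intro h
    have := congrArg Fin.val h
    simp [hi₀, hi₁] at this
    omega
  -- the character `a_{i₀} ↦ 1`, `a_{i₁} ↦ 1`, everything else `↦ 0`
  let f : puncturedSurfaceGen (g₁ + g₂) 0 → Multiplicative (ZMod ℓ) := fun y =>
    if y = Sum.inl (i₀, false) ∨ y = Sum.inl (i₁, false) then ofAdd 1 else 1
  obtain ⟨φ, hφ⟩ := PuncturedSurfaceGroup.exists_hom_of_comm f fun j => by simp [f]
  have hcard : IsSigmaInteger G.Sigma (Nat.card (Multiplicative (ZMod ℓ))) := by
    rw [show Nat.card (Multiplicative (ZMod ℓ)) = ℓ from Nat.card_zmod ℓ, hSig]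
    exact ⟨hl.pos, fun p hp hpl => (Nat.prime_dvd_prime_iff_eq hp hl).mp hpl⟩
  obtain ⟨χ, hχc, hχ⟩ := hι.exists_continuous_extend_top hcard φ
  have hχa₀ : χ (ι (PuncturedSurfaceGroup.a i₀)) = ofAdd 1 := by
    rw [PuncturedSurfaceGroup.a, hχ, hφ]; simp [f]
  have hχa₁ : χ (ι (PuncturedSurfaceGroup.a i₁)) = ofAdd 1 := by
    rw [PuncturedSurfaceGroup.a, hχ, hφ]; simp [f]
  -- the character kills the vanishing cycle, hence the node groups and `Ker(Π ↠ Π^unr)`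
  have hχz : χ (ι (List.ofFn fun i : Fin g₁ =>
      PuncturedSurfaceGroup.a (g := g₁ + g₂) (r := 0) (Fin.castAdd g₂ i) *
        PuncturedSurfaceGroup.b (Fin.castAdd g₂ i) * (PuncturedSurfaceGroup.a (Fin.castAdd g₂ i))⁻¹ *
          (PuncturedSurfaceGroup.b (Fin.castAdd g₂ i))⁻¹).prod) = 1 := by
    rw [map_list_prod, map_list_prod, List.map_ofFn, List.map_ofFn]
    exact List.prod_eq_one fun y hy => by
      obtain ⟨i, rfl⟩ := List.mem_ofFn.mp hy
      simp only [Function.comp_apply, map_mul, map_inv, mul_inv_cancel_comm, mul_inv_cancel]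
  have hunr : G.IsUnrCovering χ.ker := by
    refine G.unrKer_le_ker χ hχc (fun c => isEmptyElim c) fun e => ?_
    rw [hN e]
    exact topologicalClosure_map_zpowers_le_ker ι χ hχc _ hχz
  -- membership of the distinguished generators in the two vertex groups
  have hx₀ : ι (PuncturedSurfaceGroup.a i₀) ∈ G.vertGp v₀ := by
    rw [hV₀]
    exact Subgroup.le_topologicalClosure _ (Subgroup.mem_map_of_mem ι
      (Subgroup.subset_closure (Or.inl ⟨⟨0, h₁⟩, rfl⟩)))
  have hx₁ : ι (PuncturedSurfaceGroup.a i₁) ∈ G.vertGp v₁ := by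
    rw [hV₁]
    exact Subgroup.le_topologicalClosure _ (Subgroup.mem_map_of_mem ι
      (Subgroup.subset_closure (Or.inl ⟨⟨0, h₂⟩, rfl⟩)))
  -- `H' := Ker χ`: a normal open `Π^unr`-covering of index `ℓ`, totally ramified at `v₀`
  have hO : IsOpen (χ.ker : Set P) := (isOpen_discrete ({1} : Set _)).preimage hχc
  have hidx : χ.ker.index = ℓ := index_ker_eq_of_apply_eq hl χ hχa₀
  have htot : (1 : ConjAct P) • G.vertGp v₀ ⊔ χ.ker = ⊤ := by
    rw [one_smul]
    exact sup_ker_eq_top_of_apply_eq hl χ (G.vertGp v₀) hx₀ hχa₀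
  -- the structural consequence puts `Π_{v₁}` inside `Ker χ` — but `χ(ι a_{i₁}) = 1 ≠ 0`
  have hle := G.smul_vertGp_le_of_verticialAuxiliaryCoveringExists hAux hst hSig hO hidx hunr htot
    hne.symm 1
  rw [one_smul] at hle
  have h1 : χ (ι (PuncturedSurfaceGroup.a i₁)) = 1 := hle hx₁
  rw [hχa₁] at h1
  exact one_ne_zero (ofAdd_eq_one.mp h1)

omit [CompactSpace P] [TotallyDisconnectedSpace P] [IsTopologicalGroup P] in
/-- **At a datum of two-component shape the cuspidal and nodal conjuncts of row F-0466 hold** (no cusps;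
one node). [cite: MochizukiCombGC2007, Rmk 1.4.3 p.12] -/
theorem cuspidal_and_nodalAuxiliaryCoveringExists_of_twoComponent (G : PSCDatum P) [IsEmpty G.graph.C]
    (e₀ : G.graph.N) (hE : ∀ e, e = e₀) :
    G.CuspidalAuxiliaryCoveringExists ∧ G.NodalAuxiliaryCoveringExists :=
  haveI : Subsingleton G.graph.N := ⟨fun a b => by rw [hE a, hE b]⟩
  ⟨G.cuspidalAuxiliaryCoveringExists_of_isEmpty, G.nodalAuxiliaryCoveringExists_of_subsingleton⟩

end TwoComponent

/-! ### Row F-0466 at the two-component origin (abc-iut-w4-d052's exposed predicate) -/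

/-- **`¬ AuxiliaryCoveringsExistHolds Ω_tc` at the two-component origin.**  Let `Ω` have the
membership predicate of abc-iut-w4-d052's `exists_twoComponentOrigin_rows` (`hiff`, displayed verbatim)
and its inhabitation clause (`hinh`: every nonempty set of primes `Σ`, all genera `g₁, g₂ ≥ 1`, sturdy
for `g₁, g₂ ≥ 2`).  Then the verticial conjunct of [CombGC] Rmk. 1.4.3 (2007 text) fails at the sturdy
member with `Σ = {2}`, `g₁ = g₂ = 2` (`not_verticialAuxiliaryCoveringExists_of_twoComponent`).
[cite: MochizukiCombGC2007, Rmk 1.4.3 p.12] -/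
theorem not_auxiliaryCoveringsExistHolds_of_twoComponentOrigin (Ω : PSCOrigin.{0})
    (hiff : ∀ ⦃Q : Type⦄ [Group Q] [TopologicalSpace Q] (K : PSCDatum Q),
      Ω.IsOfPSCType K ↔
        ∃ (_ : IsTopologicalGroup Q), CompactSpace Q ∧ TotallyDisconnectedSpace Q ∧ IsEmpty K.graph.C ∧
          ∃ (g₁ g₂ : ℕ) (ι : PuncturedSurfaceGroup (g₁ + g₂) 0 →* Q) (v₀ v₁ : K.graph.V)
            (e₀ : K.graph.N), 0 < g₁ ∧ 0 < g₂ ∧ IsProSigmaCompletion K.Sigma ι ∧ v₀ ≠ v₁ ∧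
            (∀ w, w = v₀ ∨ w = v₁) ∧ (∀ e, e = e₀) ∧ K.graph.nodeEnds e₀ = s(v₀, v₁) ∧
            K.genus v₀ = g₁ ∧ K.genus v₁ = g₂ ∧
            K.vertGp v₀ = ((Subgroup.closure
              (Set.range (fun i : Fin g₁ => PuncturedSurfaceGroup.a (r := 0) (Fin.castAdd g₂ i)) ∪
                Set.range (fun i : Fin g₁ => PuncturedSurfaceGroup.b (r := 0) (Fin.castAdd g₂ i)))).map
                  ι).topologicalClosure ∧
            K.vertGp v₁ = ((Subgroup.closure
              (Set.range (fun j : Fin g₂ => PuncturedSurfaceGroup.a (r := 0) (Fin.natAdd g₁ j)) ∪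
                Set.range (fun j : Fin g₂ => PuncturedSurfaceGroup.b (r := 0) (Fin.natAdd g₁ j)))).map
                  ι).topologicalClosure ∧
            K.nodeGp e₀ = ((Subgroup.zpowers (List.ofFn fun i : Fin g₁ =>
              PuncturedSurfaceGroup.a (g := g₁ + g₂) (r := 0) (Fin.castAdd g₂ i) *
                PuncturedSurfaceGroup.b (Fin.castAdd g₂ i) *
                  (PuncturedSurfaceGroup.a (Fin.castAdd g₂ i))⁻¹ *
                    (PuncturedSurfaceGroup.b (Fin.castAdd g₂ i))⁻¹).prod).map ι).topologicalClosure)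
    (hinh : ∀ (S : Set ℕ), S.Nonempty → (∀ p ∈ S, p.Prime) → ∀ g₁ g₂ : ℕ, 0 < g₁ → 0 < g₂ →
      ∃ (Q : ProfiniteGrp.{0}) (G : PSCDatum Q), Ω.IsOfPSCType G ∧ G.Sigma = S ∧
        G.graph.i = 2 ∧ G.graph.n = 1 ∧ G.graph.r = 0 ∧
        (∃ v₀ v₁ : G.graph.V, v₀ ≠ v₁ ∧ G.genus v₀ = g₁ ∧ G.genus v₁ = g₂) ∧
        (2 ≤ g₁ → 2 ≤ g₂ → G.IsSturdy)) :
    ¬ Literature.AnabelianGeometry.SemiGraphs.PSCDatum.AuxiliaryCoveringsExistHolds Ω := by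
  obtain ⟨Q, G, hG, hS, -, -, -, -, hst⟩ :=
    hinh {2} ⟨2, Set.mem_singleton 2⟩ (fun p hp => by rw [Set.mem_singleton_iff.mp hp]; exact Nat.prime_two)
      2 2 two_pos two_pos
  obtain ⟨_, -, -, hC, g₁, g₂, ι, v₀, v₁, e₀, h₁, h₂, hι, hne, -, hE, -, -, -, hV₀, hV₁, hN₀⟩ :=
    (hiff G).mp hG
  haveI := hC
  intro h
  exact not_verticialAuxiliaryCoveringExists_of_twoComponent G hS h₁ h₂ ι hι v₀ v₁ hne hV₀ hV₁
    (fun e => by rw [hE e]; exact hN₀) (hst le_rfl le_rfl) (h G hG).2.2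

/-- **Row F-0466 DECIDED at the two-component origin, conjunct by conjunct** — appended to
abc-iut-w4-d052's `exists_twoComponentOrigin_rows` at the SAME origin (membership predicate displayed as
an `↔`): `¬ AuxiliaryCoveringsExistHolds Ω`; at every datum of `Ω` the cuspidal and nodal conjuncts of
[CombGC] Rmk. 1.4.3 (2007 text) HOLD; the verticial conjunct holds at the non-sturdy data and at the data
whose `Σ` is not a singleton, and FAILS at every sturdy datum with `Σ = {ℓ}`.
[cite: MochizukiCombGC2007, Rmk 1.4.3 p.12] -/
theorem exists_twoComponentOrigin_auxiliaryCoverings_row :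
    ∃ Ω : PSCOrigin.{0},
      (∀ ⦃Q : Type⦄ [Group Q] [TopologicalSpace Q] (K : PSCDatum Q),
        Ω.IsOfPSCType K ↔
          ∃ (_ : IsTopologicalGroup Q), CompactSpace Q ∧ TotallyDisconnectedSpace Q ∧ IsEmpty K.graph.C ∧
            ∃ (g₁ g₂ : ℕ) (ι : PuncturedSurfaceGroup (g₁ + g₂) 0 →* Q) (v₀ v₁ : K.graph.V)
              (e₀ : K.graph.N), 0 < g₁ ∧ 0 < g₂ ∧ IsProSigmaCompletion K.Sigma ι ∧ v₀ ≠ v₁ ∧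
              (∀ w, w = v₀ ∨ w = v₁) ∧ (∀ e, e = e₀) ∧ K.graph.nodeEnds e₀ = s(v₀, v₁) ∧
              K.genus v₀ = g₁ ∧ K.genus v₁ = g₂ ∧
              K.vertGp v₀ = ((Subgroup.closure
                (Set.range (fun i : Fin g₁ => PuncturedSurfaceGroup.a (r := 0) (Fin.castAdd g₂ i)) ∪
                  Set.range (fun i : Fin g₁ => PuncturedSurfaceGroup.b (r := 0) (Fin.castAdd g₂ i)))).map
                    ι).topologicalClosure ∧
              K.vertGp v₁ = ((Subgroup.closure
                (Set.range (fun j : Fin g₂ => PuncturedSurfaceGroup.a (r := 0) (Fin.natAdd g₁ j)) ∪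
                  Set.range (fun j : Fin g₂ => PuncturedSurfaceGroup.b (r := 0) (Fin.natAdd g₁ j)))).map
                    ι).topologicalClosure ∧
              K.nodeGp e₀ = ((Subgroup.zpowers (List.ofFn fun i : Fin g₁ =>
                PuncturedSurfaceGroup.a (g := g₁ + g₂) (r := 0) (Fin.castAdd g₂ i) *
                  PuncturedSurfaceGroup.b (Fin.castAdd g₂ i) *
                    (PuncturedSurfaceGroup.a (Fin.castAdd g₂ i))⁻¹ *
                      (PuncturedSurfaceGroup.b (Fin.castAdd g₂ i))⁻¹).prod).map ι).topologicalClosure) ∧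
      ¬ Literature.AnabelianGeometry.SemiGraphs.PSCDatum.AuxiliaryCoveringsExistHolds Ω ∧
      (∀ ⦃Q : Type⦄ [Group Q] [TopologicalSpace Q] [IsTopologicalGroup Q] (G : PSCDatum Q),
        Ω.IsOfPSCType G → G.CuspidalAuxiliaryCoveringExists ∧ G.NodalAuxiliaryCoveringExists) ∧
      (∀ ⦃Q : Type⦄ [Group Q] [TopologicalSpace Q] [IsTopologicalGroup Q] (G : PSCDatum Q),
        Ω.IsOfPSCType G → (¬ G.IsSturdy ∨ ∀ l : ℕ, G.Sigma ≠ {l}) → G.VerticialAuxiliaryCoveringExists) ∧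
      (∀ ⦃Q : Type⦄ [Group Q] [TopologicalSpace Q] [IsTopologicalGroup Q] (G : PSCDatum Q),
        Ω.IsOfPSCType G → G.IsSturdy → ∀ l : ℕ, G.Sigma = {l} → ¬ G.VerticialAuxiliaryCoveringExists) := by
  obtain ⟨Ω, hiff, -, hinh, -⟩ := exists_twoComponentOrigin_rows
  refine ⟨Ω, hiff, not_auxiliaryCoveringsExistHolds_of_twoComponentOrigin Ω hiff hinh,
    fun Q _ _ _ G hG => ?_, fun Q _ _ _ G hG h => ?_, fun Q _ _ _ G hG hst l hS => ?_⟩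
  · obtain ⟨_, -, -, hC, g₁, g₂, ι, v₀, v₁, e₀, -, -, -, -, -, hE, -⟩ := (hiff G).mp hG
    haveI := hC
    exact G.cuspidal_and_nodalAuxiliaryCoveringExists_of_twoComponent e₀ hE
  · exact h.elim G.verticialAuxiliaryCoveringExists_of_not_isSturdy G.verticialAuxiliaryCoveringExists_of_sigma_ne
  · obtain ⟨_, hc, hd, hC, g₁, g₂, ι, v₀, v₁, e₀, h₁, h₂, hι, hne, -, hE, -, -, -, hV₀, hV₁, hN₀⟩ :=
      (hiff G).mp hG
    haveI := hC
    haveI := hc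
    haveI := hd
    exact not_verticialAuxiliaryCoveringExists_of_twoComponent G hS h₁ h₂ ι hι v₀ v₁ hne hV₀ hV₁
      (fun e => by rw [hE e]; exact hN₀) hst

end PSCDatum

end Literature.AnabelianGeometry.SemiGraphs

end
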